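/-
Copyright (c) 2026 the pub-hodgecm-mathlib formalisation cell (harness21).  Prover seat hodgecm-mathlib-K2Liu-p06 (g2): Track B «K2-LIT»,
#184♮ = hLiu418 = stmt-HodgeConjecture-24832; socket #33w `sig_K2LiuThetaTypeContinuousVector` of the tier-1 socket module
`Cruxes/HLiu418/Lines/K2_Liu_CurveThetaSigs_U5d_ZetaS.lean` (ED. 1, sha16 a836627a4002dcd3, :344; planner K2Liu-plan (g2), LEAD F0P6-plan (g10)
GO + DEAL 2026-09-04T01:42:07Z, K2Liu-ref1 (g1) BOX #31 PASS); 2026-09-04.  Organ 2∕2 (organ 1∕2 = `Theorems/K2LiuAutomorphicVectorSmoothing`).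
-/
import Summits.HodgeConjecture.HodgeConjecture.Theorems.K2LiuAutomorphicVectorSmoothing   -- ★ organ 1∕2 (K2Liu-p06 g2): generic smoothing kit
import Literature.NumberTheory.Automorphic.UnitaryGroupPlaceInclusion                   -- ★ `inclPlaceAdelic`, `evalPlace_finPart_inclPlaceAdelic`, commutations
import Literature.NumberTheory.Automorphic.UnitaryGroupOfFormAdelicTopology              -- ★ `U(J)(𝔸_F)` locally compact, second countable, Hausdorff
import Literature.NumberTheory.Automorphic.IntegratedOperator                           -- ★ `ContRepresentation.integratedOperator`
import Literature.NumberTheory.Automorphic.HilbertRepSpectrumProofs                     -- ★ `ContRepresentation.IsUnitary.toContRep`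
import Literature.NumberTheory.K2Lit.LocalDoublingUnramifiedHecke                       -- ★ D7d: `IsSphericalHeckeEigen`
import HarnessLib

/-!
# Crux `HLiu418`, Track B road `K2_Liu`, unit U5d «`Z_S`», socket #33w:
# a continuous smoothing of a `K^S`-fixed automorphic vector keeps its spherical Hecke eigen-identities off `S`

Cell `hodgecm-mathlib`, crux item hLiu418 = `stmt-HodgeConjecture-24832`, route of record `HCCMUnconditional`; squad K2 ∕ K2Liu,
LEAD F0P6-plan (g10), planner K2Liu-plan (g2), prover K2Liu-p06 (g2).  THEOREMS ONLY (no `def`, no instance, no notation, no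
named-fact hypothesis, no `sorry`, default heartbeats); lane `--supports stmt-HodgeConjecture-24832` (count-neutral helper).

WHAT IS PROVED.  `thetaTypeContinuousVector` — statement bytes = the socket
`Summit.HodgeConjecture.HodgeConjecture.Cruxes.HLiu418.K2LiuCurveThetaSigsU5dZetaS.sig_K2LiuThetaTypeContinuousVector` VERBATIM (organ (LS5b)(i)).
For `G = U(J)` over `E∕F`, a discrete automorphic `P ⊆ L²([G], μ)`, a finite set `S` of finite places and a non-zero `u ∈ P` fixed by
`K^S_G = {k : k_∞ = 1, k_v ∈ K_{G,v} ∀ v, k_v = 1 (v ∈ S)}`: there are `w ∈ P` and a CONTINUOUS `w̃ ≠ 0` on `[G]` with `w = w̃` a.e., `w` again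
`K^S_G`-fixed, such that at every `v ∉ S`, for every Haar `ν` on `G_v` and every family `t`, eigenvalues `a`: if `u` is a `K_{G,v}`-spherical Hecke
eigenvector for `g ↦ P(ι_v g)` (★ D7d `IsSphericalHeckeEigen`, Bochner currency), so is `w`.

PROOF.  §1 a GENERIC TRANSFER LEMMA `isSphericalHeckeEigen_of_commute`: a bounded operator `B` commuting with the action `τ` carries the ★ D7d
predicate from `u` to `B u` (`ContinuousLinearMap.integrable_comp` ∕ `integral_comp_comm`).  §2 PLACE BOOKKEEPING in `G(𝔸_F)`: an element with
trivial `v`-component commutes with `ι_v(G_v)` (★ `commute_inclPlace_of_evalPlace_eq_one`, ★ `commute_archToAdelic_finAdelicToAdelic`), and the map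
`p_v : h ↦ h · ι_v(h_v)⁻¹` killing the `v`-component is a CONTINUOUS HOMOMORPHISM whose values commute with `ι_v(G_v)`.  §3 the payer: with the Borel
structure on `G(𝔸_F)` and a Haar measure `ν_G`, `K^S_G` is the compact subgroup `ker archPart ⊓ finPart⁻¹ K_f⁰ ⊓ ⨅_{v∈S} ker(evalPlace_v ∘ finPart)`
(closed inside the compact `finAdelicToAdelic(K_f⁰)`, ★ `isCompact_finAdelicIntegralLevel`); organ 1 (★ `exists_weight_integral_smul_toContRep_ne_zero`
with the open constraint `U = finPart⁻¹ K_f⁰ ⊇ K^S_G`) gives a weight `η ≥ 0`, continuous, compactly supported, left-`K^S_G`-invariant, supported in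
`U`, with `w := ∫ η(h) • P(h) u dν_G ≠ 0`; organ 1 gives the continuous representative `w̃ = S_η u` (★ orbital smoothing), `w̃ ≠ 0`, and the
`K^S_G`-fixedness.  HECKE TRANSFER at `v ∉ S` (no Fubini, no Hecke-algebra identity): on `support η` every `h` has `h_v ∈ K_{G,v}`, and `u` is
`ι_v(K_{G,v})`-fixed, so `η(h) • P(h) u = η(h) • P(p_v h) u` for ALL `h`; hence `w = B u` for the integrated operator `B = ∫ η(h) P(p_v h) dν_G` of the
unitary strongly continuous representation `P ∘ p_v` (★ `integratedOperator`), and `B` commutes with every `P(ι_v g)` by §2; §1 closes.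

DEGENERATE CORNERS (as on the socket): `N = 0`, `S = ∅`, empty `ι`, un-normalised `ν` — nothing in the proof depends on them; `w̃ ≠ 0` as a
FUNCTION follows from `w ≠ 0` in `L²` and `w = w̃` a.e.; `[CompactSpace [G]]` is carried by the socket but not used (the continuity of `S_η u` needs
only `u ∈ L¹(μ)`, true on the finite measure `μ`).

HONEST LABEL.  Count-neutral scaffold file of the K2_Liu road; it retires socket #33w, not hLiu418: `HC_CM` is proved only modulo the 7 printed
citations (2 remaining named inputs: hLiu418 = `stmt-HodgeConjecture-24832`, h413 = `stmt-HodgeConjecture-24833`) until rung 0 closes.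

## References
* [BorelJacquet1979] A. Borel, H. Jacquet, *Automorphic forms and automorphic representations*, PSPM 33.1 (1979): §4.1 (`G(𝔸) = G_∞ × G(𝔸_f)`,
  restricted products), §4.6 (the regular representation and its integrated form).
* [CartierCorvallis1979] P. Cartier, *Representations of p-adic groups: a survey*, PSPM 33.1 (1979): §IV.1 (the spherical Hecke algebra at `v`
  commutes with the action of the places away from `v`).
* [MoeglinWaldspurger1995] C. Moeglin, J.-L. Waldspurger, *Spectral decomposition and Eisenstein series* (1995): I.2.1 (smoothing by `C_c` functions).
* [Li1992] J.-S. Li, Crelle 428 (1992): §3 Thm. 3.1 (spherical Hecke eigenvectors in the doubling method).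
-/

set_option autoImplicit false
set_option linter.dupNamespace false

noncomputable section

open scoped InnerProductSpace
open MeasureTheory Measure Filter Topology Set NumberField IsDedekindDomain
open Literature.NumberTheory.Automorphic Literature.NumberTheory.Automorphic.UnitaryGroup
open Literature.NumberTheory.K2Lit.SiegelDoubled
open Summit.HodgeConjecture.HodgeConjecture.Cruxes.HLiu418.K2LiuAutomorphicVectorSmoothing

namespace Summit.HodgeConjecture.HodgeConjecture.Cruxes.HLiu418.K2LiuThetaTypeContinuousVector

/-! ## §1  Transfer of the spherical Hecke eigen-identities along a commuting bounded operator -/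

/-- **A bounded operator commuting with the action carries spherical Hecke eigenvectors to spherical Hecke eigenvectors** (same eigenvalues):
if `B ∘ τ(g) = τ(g) ∘ B` for all `g` then `IsSphericalHeckeEigen ν K t τ u a → IsSphericalHeckeEigen ν K t τ (B u) a` (★ D7d; the `K`-fixedness, the
integrability on the compact double cosets and the Bochner identity all pass through `B`: `ContinuousLinearMap.integrable_comp`,
`ContinuousLinearMap.integral_comp_comm`). [cite: Li1992, §3 Thm. 3.1] [cite: CartierCorvallis1979, §IV.1] -/
theorem isSphericalHeckeEigen_of_commute {G : Type} [Group G] [MeasurableSpace G] {ι V : Type} [NormedAddCommGroup V] [NormedSpace ℂ V]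
    [CompleteSpace V] {ν : Measure G} {K : Subgroup G} {t : ι → G} {τ : G → V →L[ℂ] V} {u : V} {a : ι → ℂ}
    (B : V →L[ℂ] V) (hB : ∀ (g : G) (x : V), B (τ g x) = τ g (B x)) (h : IsSphericalHeckeEigen ν K t τ u a) :
    IsSphericalHeckeEigen ν K t τ (B u) a := by
  have hfun : (fun g => τ g (B u)) = fun g => B (τ g u) := funext fun g => (hB g u).symm
  refine ⟨fun k hk => by rw [← hB, h.1 k hk], fun i => ⟨?_, ?_⟩⟩
  · rw [hfun]
    exact B.integrable_comp (h.2 i).1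
  · rw [hfun, B.integral_comp_comm (h.2 i).1, (h.2 i).2, map_smul]

/-! ## §2  Place bookkeeping in `U(J)(𝔸_F)`: elements with trivial `v`-component commute with `ι_v(G_v)` -/

section Place

variable {F E : Type} [Field F] [NumberField F] [Field E] [NumberField E] [Algebra F E]
  {c : E ≃ₐ[F] E} {N : ℕ} {J : Matrix (Fin N) (Fin N) E}

/-- **An element of `U(J)(𝔸_F)` with trivial `v`-component commutes with `inclPlaceAdelic v (U(J)(F_v))`** (`h = h_∞ · h_f`: the archimedean factor
commutes with the finite one, and `h_f` commutes with `inclPlace v (·)` when `(h_f)_v = 1`). [cite: BorelJacquet1979, §4.1] -/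
theorem commute_inclPlaceAdelic_of_evalPlace_eq_one {v : HeightOneSpectrum (𝓞 F)} {h : (adelicGroupData F E c N J).Adelic}
    (hh : evalPlace F E c N J v (finPart F E c N J h) = 1) (g : localPi E c N J v) :
    Commute h (inclPlaceAdelic F E c N J v g) := by
  rw [← archToAdelic_mul_finAdelicToAdelic F E c N J h, inclPlaceAdelic_apply]
  refine Commute.mul_left (commute_archToAdelic_finAdelicToAdelic F E c N J _ _) ?_
  rw [Commute, SemiconjBy, ← map_mul, ← map_mul, (commute_inclPlace_of_evalPlace_eq_one F E c N J hh g).eq]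

/-- `(h · ι_v(h_v)⁻¹)_v = 1`. [cite: BorelJacquet1979, §4.1] -/
theorem evalPlace_finPart_mul_inclPlaceAdelic_inv (v : HeightOneSpectrum (𝓞 F)) (h : (adelicGroupData F E c N J).Adelic) :
    evalPlace F E c N J v (finPart F E c N J
      (h * (inclPlaceAdelic F E c N J v (evalPlace F E c N J v (finPart F E c N J h)))⁻¹)) = 1 := by
  rw [map_mul, map_inv, map_mul, map_inv, evalPlace_finPart_inclPlaceAdelic, mul_inv_cancel]

/-- **`p_v : h ↦ h · ι_v(h_v)⁻¹` is multiplicative** (the stripped element `k · ι_v(k_v)⁻¹` commutes with `ι_v(h_v)⁻¹`). [cite: BorelJacquet1979, §4.1] -/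
theorem mul_inclPlaceAdelic_inv_mul (v : HeightOneSpectrum (𝓞 F)) (h k : (adelicGroupData F E c N J).Adelic) :
    h * k * (inclPlaceAdelic F E c N J v (evalPlace F E c N J v (finPart F E c N J (h * k))))⁻¹ =
      h * (inclPlaceAdelic F E c N J v (evalPlace F E c N J v (finPart F E c N J h)))⁻¹ *
        (k * (inclPlaceAdelic F E c N J v (evalPlace F E c N J v (finPart F E c N J k)))⁻¹) := by
  have hc := (commute_inclPlaceAdelic_of_evalPlace_eq_one (evalPlace_finPart_mul_inclPlaceAdelic_inv v k)
    (evalPlace F E c N J v (finPart F E c N J h))⁻¹).eq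
  rw [map_inv] at hc
  rw [map_mul, map_mul, map_mul, mul_inv_rev, ← mul_assoc, mul_assoc h k, mul_assoc h, hc, ← mul_assoc, ← mul_assoc]

/-- `evalPlace v g` IS the `v`-component of `finAdelicEquiv g` (coordinates). [folklore] -/
theorem evalPlace_eq_finAdelicEquiv_apply (v : HeightOneSpectrum (𝓞 F)) (g : finAdelic F E c N J) :
    evalPlace F E c N J v g = finAdelicEquiv F E c N J g v :=
  Subtype.ext (funext fun w => by rw [coe_evalPlace_apply, finAdelicEquiv_apply_coe])

/-- `K_f⁰ = ∏_v U(J)(𝒪_v)` in the `evalPlace` spelling (★ `mem_finAdelicIntegralLevel_iff_forall`). [cite: BorelJacquet1979, §4.1] -/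
theorem mem_finAdelicIntegralLevel_iff_forall_evalPlace (g : finAdelic F E c N J) :
    g ∈ finAdelicIntegralLevel F E c N J ↔ ∀ v : HeightOneSpectrum (𝓞 F), evalPlace F E c N J v g ∈ localInt E c N J v := by
  rw [mem_finAdelicIntegralLevel_iff_forall]
  simp only [evalPlace_eq_finAdelicEquiv_apply]

end Place

/-! ## §3  Payment of socket #33w -/

set_option maxHeartbeats 400000 in
/-- **PAYMENT OF socket #33w `sig_K2LiuThetaTypeContinuousVector`** (organ (LS5b)(i) «A CONTINUOUS SMOOTHING OF A `K^S`-FIXED VECTOR KEEPS ITS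
HECKE EIGEN-IDENTITIES», unit U5d of the K2_Liu road; statement VERBATIM).  `P ⊆ L²([G])` discrete automorphic for `G = U(J)`, `u ∈ P` non-zero and
fixed by `K^S_G` ⟹ ∃ `w ∈ P`, `w̃` continuous, `w̃ ≠ 0`, `w = w̃` a.e., `w` fixed by `K^S_G`, and every `IsSphericalHeckeEigen ν K_{G,v} t (P ∘ ι_v) u a`
at `v ∉ S` transfers to `w`.  Proof: `w := ∫ η(h) • P(h) u dν_G` for an invariant bump `η` near `K^S_G` supported in `finPart⁻¹ K_f⁰` (organ 1), and the
Hecke transfer through the integrated operator of `P ∘ p_v` (§1, §2). [cite: BorelJacquet1979, §4.6] [cite: CartierCorvallis1979, §IV.1]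
[cite: MoeglinWaldspurger1995, I.2.1] [cite: Li1992, §3 Thm. 3.1] -/
theorem thetaTypeContinuousVector :
    ∀ (F E : Type) [Field F] [NumberField F] [Field E] [NumberField E] [Algebra F E] [Algebra.IsQuadraticExtension F E]
      (c : E ≃ₐ[F] E) (N : ℕ) (J : Matrix (Fin N) (Fin N) E)
      (μ : Measure (UnitaryGroup.adelicGroupData F E c N J).automorphicQuotient)
      [(UnitaryGroup.adelicGroupData F E c N J).IsAutomorphicMeasure μ]
      [CompactSpace (UnitaryGroup.adelicGroupData F E c N J).automorphicQuotient]
      (P : DiscreteAutomorphicRep (UnitaryGroup.adelicGroupData F E c N J) μ)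
      (S : Finset (HeightOneSpectrum (𝓞 F)))
      (u : P.space.toSubmodule) (_hu : u ≠ 0)
      -- `u` is fixed by `K^S_G`
      (_huK : ∀ k : (UnitaryGroup.adelicGroupData F E c N J).Adelic,
        UnitaryGroup.archPart F E c N J k = 1 →
        (∀ v, UnitaryGroup.evalPlace F E c N J v (UnitaryGroup.finPart F E c N J k) ∈ UnitaryGroup.localInt E c N J v) →
        (∀ v ∈ S, UnitaryGroup.evalPlace F E c N J v (UnitaryGroup.finPart F E c N J k) = 1) →
        P.space.toContRep k u = u),
      ∃ (w : P.space.toSubmodule) (wc : (UnitaryGroup.adelicGroupData F E c N J).automorphicQuotient → ℂ),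
        Continuous wc ∧ wc ≠ 0 ∧
        (((w : Lp ℂ 2 μ) : (UnitaryGroup.adelicGroupData F E c N J).automorphicQuotient → ℂ) =ᵐ[μ] wc) ∧
        (∀ k : (UnitaryGroup.adelicGroupData F E c N J).Adelic,
          UnitaryGroup.archPart F E c N J k = 1 →
          (∀ v, UnitaryGroup.evalPlace F E c N J v (UnitaryGroup.finPart F E c N J k) ∈ UnitaryGroup.localInt E c N J v) →
          (∀ v ∈ S, UnitaryGroup.evalPlace F E c N J v (UnitaryGroup.finPart F E c N J k) = 1) →
          P.space.toContRep k w = w) ∧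
        ∀ (v : HeightOneSpectrum (𝓞 F)), v ∉ S →
          ∀ [MeasurableSpace (UnitaryGroup.localPi E c N J v)] [BorelSpace (UnitaryGroup.localPi E c N J v)]
            (ν : Measure (UnitaryGroup.localPi E c N J v)) [ν.IsHaarMeasure]
            {ι : Type} (t : ι → UnitaryGroup.localPi E c N J v) (a : ι → ℂ),
            IsSphericalHeckeEigen ν (UnitaryGroup.localInt E c N J v) t
                (fun g' => P.space.toContRep (UnitaryGroup.inclPlaceAdelic F E c N J v g')) u a →
              IsSphericalHeckeEigen ν (UnitaryGroup.localInt E c N J v) t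
                (fun g' => P.space.toContRep (UnitaryGroup.inclPlaceAdelic F E c N J v g')) w a := by
  intro F E _ _ _ _ _ _ c N J μ _ _ P S u hu huK
  -- the group `G = U(J)(𝔸_F)`: topology instances, Borel structure, a Haar measure
  haveI : LocallyCompactSpace (adelicGroupData F E c N J).Adelic := inferInstanceAs (LocallyCompactSpace (adelic F E c N J))
  haveI : SecondCountableTopology (adelicGroupData F E c N J).Adelic := inferInstanceAs (SecondCountableTopology (adelic F E c N J))
  letI : MeasurableSpace (adelicGroupData F E c N J).Adelic := borel _
  haveI : BorelSpace (adelicGroupData F E c N J).Adelic := ⟨rfl⟩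
  obtain ⟨νG, hνG⟩ : ∃ ν' : Measure (adelicGroupData F E c N J).Adelic, ν'.IsHaarMeasure := ⟨Measure.haar, inferInstance⟩
  -- the level `K^S_G` as a subgroup of `G`
  obtain ⟨KS, hmemKS⟩ : ∃ KS : Subgroup (adelicGroupData F E c N J).Adelic, ∀ k, k ∈ KS ↔ archPart F E c N J k = 1 ∧
      (∀ v, evalPlace F E c N J v (finPart F E c N J k) ∈ localInt E c N J v) ∧
      ∀ v ∈ S, evalPlace F E c N J v (finPart F E c N J k) = 1 := by
    refine ⟨(archPart F E c N J).ker ⊓ (finAdelicIntegralLevel F E c N J).comap (finPart F E c N J) ⊓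
      ⨅ v ∈ S, ((evalPlace F E c N J v).comp (finPart F E c N J)).ker, fun k => ?_⟩
    simp only [Subgroup.mem_inf, MonoidHom.mem_ker, Subgroup.mem_comap, Subgroup.mem_iInf, MonoidHom.coe_comp, Function.comp_apply,
      mem_finAdelicIntegralLevel_iff_forall_evalPlace, and_assoc]
  have hfix : ∀ k ∈ KS, P.space.toContRep k u = u := fun k hk =>
    huK k ((hmemKS k).1 hk).1 ((hmemKS k).1 hk).2.1 ((hmemKS k).1 hk).2.2
  -- `K^S_G` is compact: closed inside the compact `finAdelicToAdelic '' K_f⁰`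
  have hKSc : IsCompact (KS : Set (adelicGroupData F E c N J).Adelic) := by
    have hbig : IsCompact (finAdelicToAdelic F E c N J '' (finAdelicIntegralLevel F E c N J : Set (finAdelic F E c N J))) :=
      (isCompact_finAdelicIntegralLevel F E c N J).image (continuous_finAdelicToAdelic F E c N J)
    have hclosed : IsClosed (KS : Set (adelicGroupData F E c N J).Adelic) := by
      have hEq : (KS : Set (adelicGroupData F E c N J).Adelic) = (archPart F E c N J ⁻¹' {1}) ∩
          (finPart F E c N J ⁻¹' (finAdelicIntegralLevel F E c N J : Set (finAdelic F E c N J))) ∩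
          ⋂ v ∈ S, ((fun k => evalPlace F E c N J v (finPart F E c N J k)) ⁻¹' {1}) := by
        ext k
        simp only [SetLike.mem_coe, hmemKS, Set.mem_inter_iff, Set.mem_preimage, Set.mem_singleton_iff, Set.mem_iInter,
          mem_finAdelicIntegralLevel_iff_forall_evalPlace, and_assoc]
      rw [hEq]
      refine (IsClosed.inter (isClosed_singleton.preimage (continuous_archPart F E c N J)) ?_).inter ?_
      · exact ((finAdelicIntegralLevel F E c N J).isClosed_of_isOpen (isOpen_finAdelicIntegralLevel F E c N J)).preimage
          (continuous_finPart F E c N J)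
      · exact isClosed_biInter fun v _ =>
          isClosed_singleton.preimage ((continuous_evalPlace F E c N J v).comp (continuous_finPart F E c N J))
    refine hbig.of_isClosed_subset hclosed fun k hk => ?_
    obtain ⟨hk1, hk2, -⟩ := (hmemKS k).1 hk
    refine ⟨finPart F E c N J k, (mem_finAdelicIntegralLevel_iff_forall_evalPlace (finPart F E c N J k)).2 hk2, ?_⟩
    have := archToAdelic_mul_finAdelicToAdelic F E c N J k
    rwa [hk1, map_one, one_mul] at this
  -- the open constraint `U = finPart⁻¹ K_f⁰ ⊇ K^S_G`
  have hUo : IsOpen (finPart F E c N J ⁻¹' (finAdelicIntegralLevel F E c N J : Set (finAdelic F E c N J))) :=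
    (isOpen_finAdelicIntegralLevel F E c N J).preimage (continuous_finPart F E c N J)
  have hKU : (KS : Set (adelicGroupData F E c N J).Adelic) ⊆ finPart F E c N J ⁻¹' (finAdelicIntegralLevel F E c N J : Set (finAdelic F E c N J)) :=
    fun k hk => (mem_finAdelicIntegralLevel_iff_forall_evalPlace _).2 ((hmemKS k).1 hk).2.1
  -- the weight and the smoothed vector
  obtain ⟨η, hη, hηs, -, hηK, hsupp, hne⟩ :=
    exists_weight_integral_smul_toContRep_ne_zero (adelicGroupData F E c N J) νG P.space hKSc hfix hu hUo hKU
  refine ⟨∫ g, (η g : ℂ) • P.space.toContRep g u ∂νG,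
    orbitalSmoothing νG (fun g => (η g : ℂ)) (((u : P.space.toSubmodule) : (adelicGroupData F E c N J).L2 μ) : (adelicGroupData F E c N J).automorphicQuotient → ℂ),
    continuous_orbitalSmoothing_coe (adelicGroupData F E c N J) νG hη hηs _, ?_, integral_weight_smul_toContRep_ae_eq_orbitalSmoothing (adelicGroupData F E c N J) νG P.space hη hηs u,
    fun k hk1 hk2 hk3 => toContRep_integral_weight_smul_eq_self (adelicGroupData F E c N J) νG P.space hη hηs hηK u ((hmemKS k).2 ⟨hk1, hk2, hk3⟩), ?_⟩
  · -- `w̃ ≠ 0`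
    exact repr_ne_zero_of_ne_zero (adelicGroupData F E c N J) (fun h0 => hne (Subtype.ext h0))
      (integral_weight_smul_toContRep_ae_eq_orbitalSmoothing (adelicGroupData F E c N J) νG P.space hη hηs u)
  · -- the Hecke transfer at `v ∉ S`
    intro v hvS _ _ ν _ ι t a hE
    -- on the support of `η` the `v`-component is integral
    have hηv : ∀ h : (adelicGroupData F E c N J).Adelic, η h ≠ 0 → evalPlace F E c N J v (finPart F E c N J h) ∈ localInt E c N J v := fun h hh =>
      (mem_finAdelicIntegralLevel_iff_forall_evalPlace _).1 (hsupp (Function.mem_support.2 hh)) v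
    -- `ι_v(K_{G,v}) ≤ K^S_G` (as `v ∉ S`)
    have hιK : ∀ k ∈ localInt E c N J v, inclPlaceAdelic F E c N J v k ∈ KS := by
      intro k hk
      refine (hmemKS _).2 ⟨archPart_inclPlaceAdelic F E c N J v k, fun v' => ?_, fun v' hv' => ?_⟩
      · rw [finPart_inclPlaceAdelic]
        rcases eq_or_ne v' v with rfl | hne'
        · rwa [evalPlace_inclPlace]
        · rw [evalPlace_inclPlace_of_ne F E c N J hne']; exact one_mem _
      · rw [finPart_inclPlaceAdelic, evalPlace_inclPlace_of_ne F E c N J (by rintro rfl; exact hvS hv')]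
    -- the homomorphism `p_v : h ↦ h · ι_v(h_v)⁻¹`
    obtain ⟨pv, hpv⟩ : ∃ pv : (adelicGroupData F E c N J).Adelic →* (adelicGroupData F E c N J).Adelic,
        ∀ h, pv h = h * (inclPlaceAdelic F E c N J v (evalPlace F E c N J v (finPart F E c N J h)))⁻¹ :=
      ⟨{ toFun := fun h => h * (inclPlaceAdelic F E c N J v (evalPlace F E c N J v (finPart F E c N J h)))⁻¹
         map_one' := by rw [map_one, map_one, map_one, inv_one, mul_one]
         map_mul' := fun h k => mul_inclPlaceAdelic_inv_mul v h k }, fun _ => rfl⟩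
    have hpvc : Continuous pv := by
      have : (pv : (adelicGroupData F E c N J).Adelic → (adelicGroupData F E c N J).Adelic) =
          fun h => h * (inclPlaceAdelic F E c N J v (evalPlace F E c N J v (finPart F E c N J h)))⁻¹ := funext hpv
      rw [this]
      exact continuous_id.mul
        ((continuous_inclPlaceAdelic F E c N J v).comp ((continuous_evalPlace F E c N J v).comp (continuous_finPart F E c N J))).inv
    have hcomm : ∀ (h : (adelicGroupData F E c N J).Adelic) (g : localPi E c N J v),
        pv h * inclPlaceAdelic F E c N J v g = inclPlaceAdelic F E c N J v g * pv h :=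
      fun h g => by
        rw [hpv]
        exact (commute_inclPlaceAdelic_of_evalPlace_eq_one (evalPlace_finPart_mul_inclPlaceAdelic_inv v h) g).eq
    -- the representation `P ∘ p_v` and its integrated operator `B = ∫ η(h) P(p_v h) dν_G`
    obtain ⟨π', hπ'⟩ : ∃ π' : ContRepresentation ℂ (adelicGroupData F E c N J).Adelic P.space.toSubmodule,
        ∀ h, π' h = P.space.toContRep (pv h) :=
      ⟨ContRepresentation.ofMonoidHom (P.space.toContRep.toMonoidHom.comp pv), fun _ => rfl⟩
    have hu' : π'.IsUnitary := fun h => by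
      rw [hπ']; exact ContRepresentation.IsUnitary.toContRep ((adelicGroupData F E c N J).isUnitary_rightRegular μ) P.space (pv h)
    have hc' : π'.IsStronglyContinuous := fun x => by
      have : (fun h => π' h x) = fun h => P.space.toContRep (pv h) x := funext fun h => by rw [hπ']
      rw [this]
      exact (continuous_toContRep_apply (adelicGroupData F E c N J) P.space x).comp hpvc
    obtain ⟨θ, hθ⟩ : ∃ θ : CompactlySupportedContinuousMap (adelicGroupData F E c N J).Adelic ℂ, ∀ h, θ h = (η h : ℂ) :=
      ⟨⟨⟨fun h => (η h : ℂ), Complex.continuous_ofReal.comp hη⟩, hηs.comp_left Complex.ofReal_zero⟩, fun _ => rfl⟩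
    have hBapply : ∀ x, π'.integratedOperator hu' hc' νG θ x = ∫ h, (η h : ℂ) • P.space.toContRep (pv h) x ∂νG := fun x => by
      rw [ContRepresentation.integratedOperator_apply]
      exact integral_congr_ae (Eventually.of_forall fun h => by simp only [hθ, hπ'])
    -- `w = B u`: on `support η`, `P(h) u = P(p_v h) u`
    have hwB : (∫ g, (η g : ℂ) • P.space.toContRep g u ∂νG) = π'.integratedOperator hu' hc' νG θ u := by
      rw [hBapply]
      refine integral_congr_ae (Eventually.of_forall fun h => ?_)
      by_cases hh : η h = 0
      · simp only [hh, Complex.ofReal_zero, zero_smul]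
      · change (η h : ℂ) • P.space.toContRep h u = (η h : ℂ) • P.space.toContRep (pv h) u
        congr 1
        have hsplit : h = pv h * inclPlaceAdelic F E c N J v (evalPlace F E c N J v (finPart F E c N J h)) := by
          rw [hpv, inv_mul_cancel_right]
        conv_lhs => rw [hsplit, map_mul]
        change P.space.toContRep (pv h) (P.space.toContRep
          (inclPlaceAdelic F E c N J v (evalPlace F E c N J v (finPart F E c N J h))) u) = _
        rw [hfix _ (hιK _ (hηv h hh))]
    -- `B` commutes with `P(ι_v g)`
    have hBcomm : ∀ (g : localPi E c N J v) (x : P.space.toSubmodule),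
        π'.integratedOperator hu' hc' νG θ (P.space.toContRep (inclPlaceAdelic F E c N J v g) x) =
          P.space.toContRep (inclPlaceAdelic F E c N J v g) (π'.integratedOperator hu' hc' νG θ x) := by
      intro g x
      have hint : Integrable (fun h => (η h : ℂ) • P.space.toContRep (pv h) x) νG := by
        have h1 := ContRepresentation.integrable_smul_apply hc' νG θ x
        refine h1.congr (Eventually.of_forall fun h => ?_)
        change θ h • π' h x = (η h : ℂ) • P.space.toContRep (pv h) x
        rw [hθ, hπ']
      rw [hBapply, hBapply, ← ContinuousLinearMap.integral_comp_comm _ hint]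
      refine integral_congr_ae (Eventually.of_forall fun h => ?_)
      change (η h : ℂ) • P.space.toContRep (pv h) (P.space.toContRep (inclPlaceAdelic F E c N J v g) x) =
        P.space.toContRep (inclPlaceAdelic F E c N J v g) ((η h : ℂ) • P.space.toContRep (pv h) x)
      have hc2 : P.space.toContRep (pv h) (P.space.toContRep (inclPlaceAdelic F E c N J v g) x) =
          P.space.toContRep (inclPlaceAdelic F E c N J v g) (P.space.toContRep (pv h) x) := by
        have h2 := congrArg (fun z => P.space.toContRep z x) (hcomm h g)
        simpa only [map_mul, ContinuousLinearMap.mul_def, ContinuousLinearMap.coe_comp, Function.comp_apply] using h2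
      rw [map_smul, hc2]
    rw [hwB]
    exact isSphericalHeckeEigen_of_commute _ hBcomm hE

end Summit.HodgeConjecture.HodgeConjecture.Cruxes.HLiu418.K2LiuThetaTypeContinuousVector

end
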